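import Mathlib
import Literature.NumberTheory.LFunctions.Zhang2022.ToolkitRoughEulerMajorant
import Literature.NumberTheory.LFunctions.Zhang2022.TypedSection16B
import Literature.NumberTheory.LFunctions.Zhang2022.TypedSection15B
import HarnessLib

/-!
# Zhang (2022) §16 (16.15), "the constraint `n₁ ∈ 𝔫(𝔮)` can be removed": preparatory lemmas
# (`τ₃` multiplicative, `|(ν∗χ)(n)| ≤ τ₃(n)`, the non-smooth sum ≤ smooth × rough double sum, and the
# rough-window `τ₃`-sum `Σ_{(b,𝔮)=1, b<N} τ₃(b)/b ≪ (log N/log D⁴)³`)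

Topic `Literature/NumberTheory/LFunctions/Zhang2022` (Landau–Siegel audit tree; verdict-neutral).
Y. Zhang, *Discrete mean estimates and the Landau–Siegel zero*, arXiv:2211.02515v1 (2022)
[Zhang2022LandauSiegel] — **an unrefereed manuscript under adjudication**; nothing here bears on its
Theorems 1–2. ZHANG-L discharge lane (WP16, seat zl-w16-p4, helper of zl-w16-p8), toward the typed node
`Typed.Section16B.Inline16_nsetRemovable c′` (§16 p. 94, tex L4638, inline claim after (16.15): "On the
right side above, the constraint `n₁ ∈ 𝔫(𝔮)` can be removed with an acceptable error"), whose route of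
record is: write every `n₁ < T` outside `𝒩(𝔮)` as `n₁ = mb` (`m ∈ 𝒩(𝔮)`, `(b,𝔮) = 1`, `b > 1`;
§15 p. 86 "every `n` can be uniquely written as …", tree `Typed.Section15B.exists_smooth_mul_rough` /
`smooth_mul_rough_unique`), bound `|(ν∗χ)(mb)| ≤ τ₃(m)τ₃(b)` and `|ϖ₂ⱼ(mb)| ≤ |ϖ₂ⱼ(m)|·|ϖ₂ⱼ^{loc}(b)|`, and
sum the smooth factor by `Inline16_varpi2WeightSum` and the rough factor over the window `D⁴ ≤ q < T`.
PROVED here (theorems only; no definitions, no named facts):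

* `tau3R_eq_sigma_mul_zeta`, `tau3R_mul_of_coprime`, `tau3R_prime_pow` — `τ₃ = σ₀ ∗ 𝟙` (the typed
  `Typed.Section16B.tau3R`) is multiplicative with `τ₃(q^r) = (r+1)(r+2)/2`;
* `norm_nuConvChi_le_tau3R` — `|(ν∗χ)(n)| ≤ τ₃(n)` (`(ν∗χ)(n) = Σ_{m∣n}χ(m)τ₂(m)`,
  `Typed.Section16B.nuConvChi_eq_sum_divisors`);
* `sum_not_nset_le_sum_smooth_mul_rough` — for `f ≥ 0`,
  `Σ_{n<N, n∉𝒩(𝔮)} f(n) ≤ Σ_{m<N, m∈𝒩(𝔮)} Σ_{2≤b<N, (b,𝔮)=1} f(mb)`;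
* `tau3R_le_multMajorant`, `sum_rough_tau3R_div_le` — `τ₃(b) ≤ ∏_{q^r∥b} 3·(3/2)^r`-type majorant and,
  by the tree's window Euler-product device (`SmoothEulerMajorant.sum_factored_multMajorant_div_le_prod`,
  `prod_primes_window_one_add_le`), `Σ_{b<N,(b,𝔮)=1} τ₃(b)/b ≤ e^{58 + 48/log(D⁴−1)}(log N/log(D⁴−1))³`
  for `2 ≤ D⁴ − 1`, `D⁴ ≤ N`.

## References

* Y. Zhang, arXiv:2211.02515v1 (2022), §16 (16.15) p. 94, tex L4634–L4640; §15 p. 86 (tex L4252).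
  [cite: Zhang2022LandauSiegel, §16 (16.15) p.94]
-/

noncomputable section

open Real Finset ArithmeticFunction
open scoped ArithmeticFunction.sigma ArithmeticFunction.zeta
open Literature.NumberTheory.LFunctions.Zhang2022
open Literature.NumberTheory.LFunctions.Zhang2022.Skeleton
open Literature.NumberTheory.LFunctions.Zhang2022.SmoothEulerMajorant

namespace Literature.NumberTheory.LFunctions.Zhang2022.Typed.Section16B

/-! ## `τ₃` is multiplicative; `|(ν∗χ)| ≤ τ₃` -/

/-- `τ₃ = σ₀ ∗ 𝟙`: the typed `tau3R n = Σ_{m∣n} τ₂(m)` is the arithmetic function `σ₀ * ζ` (cast to `ℝ`).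
[cite: Zhang2022LandauSiegel, §16 p.94] -/
theorem tau3R_eq_sigma_mul_zeta (n : ℕ) : tau3R n = (((σ 0 * ζ : ArithmeticFunction ℕ) n : ℕ) : ℝ) := by
  rw [tau3R, mul_zeta_apply, Nat.cast_sum]
  refine Finset.sum_congr rfl fun m _ => ?_
  rw [sigma_zero_apply]

/-- **`τ₃` is multiplicative**: `τ₃(mn) = τ₃(m)τ₃(n)` for coprime `m, n`.
[cite: Zhang2022LandauSiegel, §16 p.94] -/
theorem tau3R_mul_of_coprime {m n : ℕ} (h : Nat.Coprime m n) : tau3R (m * n) = tau3R m * tau3R n := by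
  have hmult : IsMultiplicative (σ 0 * ζ : ArithmeticFunction ℕ) :=
    isMultiplicative_sigma.mul isMultiplicative_zeta
  rw [tau3R_eq_sigma_mul_zeta, tau3R_eq_sigma_mul_zeta, tau3R_eq_sigma_mul_zeta,
    hmult.map_mul_of_coprime h, Nat.cast_mul]

/-- `τ₃(q^r) = (r+1)(r+2)/2` at a prime power. [cite: Zhang2022LandauSiegel, §16 p.94] -/
theorem tau3R_prime_pow {q : ℕ} (hq : q.Prime) (r : ℕ) :
    tau3R (q ^ r) = ((r + 1) * (r + 2) : ℝ) / 2 := by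
  rw [tau3R, Nat.divisors_prime_pow hq, Finset.sum_map]
  simp only [Function.Embedding.coeFn_mk, Nat.divisors_prime_pow hq, Finset.card_map,
    Finset.card_range]
  -- `Σ_{i=0}^{r} (i+1) = (r+1)(r+2)/2`
  induction r with
  | zero => norm_num
  | succ r ih =>
    rw [Finset.sum_range_succ, ih]
    push_cast
    ring

/-- `τ₃ ≥ 0`. [folklore] -/
private theorem tau3R_nonneg' (n : ℕ) : 0 ≤ tau3R n :=
  Finset.sum_nonneg fun _ _ => Nat.cast_nonneg _

/-- **`|(ν∗χ)(n)| ≤ τ₃(n)`** (`n ≥ 1`; `(ν∗χ)(n) = Σ_{m∣n}χ(m)τ₂(m)`, `|χ| ≤ 1`).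
[cite: Zhang2022LandauSiegel, §16 (16.15) p.94] -/
theorem norm_nuConvChi_le_tau3R {D : ℕ} [NeZero D] (χ : DirichletCharacter ℂ D) {n : ℕ} (hn : 1 ≤ n) :
    ‖nuConvChi χ n‖ ≤ tau3R n := by
  rw [nuConvChi_eq_sum_divisors χ hn, tau3R]
  refine (norm_sum_le _ _).trans (Finset.sum_le_sum fun m _ => ?_)
  rw [norm_mul, Complex.norm_natCast]
  calc ‖χ (m : ZMod D)‖ * (m.divisors.card : ℝ) ≤ 1 * (m.divisors.card : ℝ) :=
        mul_le_mul_of_nonneg_right (DirichletCharacter.norm_le_one χ _) (Nat.cast_nonneg _)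
    _ = (m.divisors.card : ℝ) := one_mul _

/-! ## The non-smooth part of `[1,N)` is covered by (smooth part) × (rough part > 1) -/

open scoped Classical in
/-- **Removing the constraint `n ∈ 𝒩(𝔮)`, combinatorial half**: for a nonnegative `f`,
`Σ_{1≤n<N, n∉𝒩(𝔮)} f(n) ≤ Σ_{1≤m<N, m∈𝒩(𝔮)} Σ_{2≤b<N, (b,𝔮)=1} f(mb)` — every `n ≥ 1` is uniquely
`mb` with `m ∈ 𝒩(𝔮)` and `(b,𝔮) = 1` (`Typed.Section15B.exists_smooth_mul_rough`,
`smooth_mul_rough_unique`), and `b ≠ 1` when `n ∉ 𝒩(𝔮)`. [cite: Zhang2022LandauSiegel, §16 (16.15) p.94; §15 p.86] -/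
theorem sum_not_nset_le_sum_smooth_mul_rough (D N : ℕ) {f : ℕ → ℝ} (hf : ∀ n, 0 ≤ f n) :
    ∑ n ∈ (Finset.Ico 1 N).filter (fun n => n ∉ nset (frakq D)), f n ≤
      ∑ m ∈ (Finset.Ico 1 N).filter (fun m => m ∈ nset (frakq D)),
        ∑ b ∈ (Finset.Ico 2 N).filter (fun b => Nat.Coprime b (frakq D)), f (m * b) := by
  set K := frakq D with hK
  set X := (Finset.Ico 1 N).filter (fun n => n ∉ nset K) with hX
  set S := (Finset.Ico 1 N).filter (fun m => m ∈ nset K) with hS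
  set R := (Finset.Ico 2 N).filter (fun b => Nat.Coprime b K) with hR
  -- the multiplication map on `S × R` is injective
  have hinj : Set.InjOn (fun x : ℕ × ℕ => x.1 * x.2) ↑(S ×ˢ R) := by
    rintro ⟨m, b⟩ hx ⟨m', b'⟩ hx' heq
    simp only [Finset.coe_product, Set.mem_prod, Finset.mem_coe, hS, hR, Finset.mem_filter] at hx hx'
    have heq' : m * b = m' * b' := by simpa using heq
    obtain ⟨h1, h2⟩ := Typed.Section15B.smooth_mul_rough_unique heq' hx.1.2 hx.2.2 hx'.1.2 hx'.2.2
    rw [h1, h2]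
  -- `X ⊆ image`
  have hsub : X ⊆ (S ×ˢ R).image (fun x : ℕ × ℕ => x.1 * x.2) := by
    intro n hn
    rw [hX, Finset.mem_filter, Finset.mem_Ico] at hn
    obtain ⟨⟨hn1, hnN⟩, hnot⟩ := hn
    obtain ⟨m, b, hmb, hm, hb⟩ := Typed.Section15B.exists_smooth_mul_rough D (show n ≠ 0 by omega)
    rw [Finset.mem_image]
    refine ⟨(m, b), ?_, hmb⟩
    have hm0 : 0 < m := hm.1
    have hb0 : 0 < b := Nat.pos_of_ne_zero (by rintro rfl; rw [mul_zero] at hmb; omega)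
    have hb1 : b ≠ 1 := by
      rintro rfl
      rw [mul_one] at hmb
      exact hnot (hmb ▸ hm)
    have hmle : m ≤ n := by rw [← hmb]; exact Nat.le_mul_of_pos_right m hb0
    have hble : b ≤ n := by rw [← hmb]; exact Nat.le_mul_of_pos_left b hm0
    simp only [Finset.mem_product, hS, hR, Finset.mem_filter, Finset.mem_Ico]
    exact ⟨⟨⟨hm0, lt_of_le_of_lt hmle hnN⟩, hm⟩, ⟨⟨by omega, lt_of_le_of_lt hble hnN⟩, hb⟩⟩
  calc ∑ n ∈ X, f n ≤ ∑ n ∈ (S ×ˢ R).image (fun x : ℕ × ℕ => x.1 * x.2), f n :=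
        Finset.sum_le_sum_of_subset_of_nonneg hsub fun n _ _ => hf n
    _ = ∑ x ∈ S ×ˢ R, f (x.1 * x.2) := Finset.sum_image hinj
    _ = ∑ m ∈ S, ∑ b ∈ R, f (m * b) := Finset.sum_product _ _ _

/-! ## The rough-window `τ₃`-sum -/

/-- A multiplicative majorant of `τ₃`: `τ₃(b) ≤ ∏_{q^r∥b} a(r)` with `a(1) = 3`, `a(r) = 3(3/2)^r`
(`r ≥ 2`; `(r+1)(r+2)/2 ≤ 3(3/2)^r`), for `b ≥ 1`. [cite: Zhang2022LandauSiegel, §16 (16.15) p.94] -/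
theorem tau3R_le_multMajorant {b : ℕ} (hb : b ≠ 0) :
    tau3R b ≤ ∏ q ∈ b.primeFactors,
      (fun (_ : ℕ) (r : ℕ) => if r = 1 then (3 : ℝ) else 3 * (3 / 2 : ℝ) ^ r) q (b.factorization q) := by
  have hmult : IsMultiplicative (σ 0 * ζ : ArithmeticFunction ℕ) :=
    isMultiplicative_sigma.mul isMultiplicative_zeta
  rw [tau3R_eq_sigma_mul_zeta, hmult.multiplicative_factorization _ hb, Finsupp.prod,
    Nat.support_factorization, Nat.cast_prod]
  refine Finset.prod_le_prod (fun q _ => Nat.cast_nonneg _) fun q hq => ?_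
  have hqp : q.Prime := Nat.prime_of_mem_primeFactors hq
  have hr0 : b.factorization q ≠ 0 := by
    rw [← Finsupp.mem_support_iff, Nat.support_factorization]; exact hq
  have hval : (((σ 0 * ζ : ArithmeticFunction ℕ) (q ^ b.factorization q) : ℕ) : ℝ) =
      ((b.factorization q + 1) * (b.factorization q + 2) : ℝ) / 2 := by
    rw [← tau3R_eq_sigma_mul_zeta, tau3R_prime_pow hqp]
  rw [hval]
  set r := b.factorization q with hr
  -- `(r+1)(r+2)/2 ≤ 3` for `r = 1`, `≤ 3(3/2)^r` for `r ≥ 2`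
  beta_reduce
  split_ifs with h1
  · rw [h1]; norm_num
  · have hr2 : 2 ≤ r := by omega
    -- induction from `r = 2`: `(r+1)(r+2)/2 ≤ 3(3/2)^r`
    have key : ∀ k : ℕ, ((k + 2 + 1 : ℝ) * (k + 2 + 2)) / 2 ≤ 3 * (3 / 2 : ℝ) ^ (k + 2) := by
      intro k
      induction k with
      | zero => norm_num
      | succ k ih =>
        rcases Nat.eq_zero_or_pos k with hk0 | hk1
        · subst hk0; norm_num
        · have h32 : (3 : ℝ) * (3 / 2) ^ (k + 1 + 2) = 3 / 2 * (3 * (3 / 2) ^ (k + 2)) := by ring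
          rw [h32]
          have hk : (1 : ℝ) ≤ k := by exact_mod_cast hk1
          push_cast at ih ⊢
          nlinarith [mul_nonneg (show (0 : ℝ) ≤ k + 4 by linarith) (show (0 : ℝ) ≤ k - 1 by linarith)]
    obtain ⟨k, hk⟩ : ∃ k, r = k + 2 := ⟨r - 2, by omega⟩
    rw [hk]
    have := key k
    push_cast at this ⊢
    exact this

/-- The local Euler sum of the `τ₃`-majorant: `Σ_{r≥0} a(r+1)/q^{r+1} ≤ 3/q + 27/q²` and it converges
(`q ≥ 2`; geometric tail `Σ_{r≥0}(3/(2q))^{r+2} ≤ 9/q²`). [folklore] -/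
private theorem tau3_local_euler_sum_le {q : ℕ} (hq : 2 ≤ q) :
    Summable (fun r : ℕ =>
        (if r + 1 = 1 then (3 : ℝ) else 3 * (3 / 2 : ℝ) ^ (r + 1)) / (q : ℝ) ^ (r + 1)) ∧
      ∑' r : ℕ, (if r + 1 = 1 then (3 : ℝ) else 3 * (3 / 2 : ℝ) ^ (r + 1)) / (q : ℝ) ^ (r + 1) ≤
        (3 : ℝ) / q + 27 / (q : ℝ) ^ 2 := by
  have hq0 : (0 : ℝ) < q := by exact_mod_cast (show 0 < q by omega)
  have hq2 : (2 : ℝ) ≤ q := by exact_mod_cast hq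
  set x : ℝ := 3 / (2 * (q : ℝ)) with hx
  have hx0 : 0 ≤ x := by rw [hx]; positivity
  have hx34 : x ≤ 3 / 4 := by
    rw [hx, div_le_div_iff₀ (by positivity) (by norm_num)]; nlinarith
  have hx1 : x < 1 := by linarith
  have hgeom : HasSum (fun r : ℕ => x ^ r) (1 - x)⁻¹ := hasSum_geometric_of_lt_one hx0 hx1
  have hs : Summable (fun r : ℕ => x ^ (r + 2)) := by
    simp_rw [pow_add]; exact hgeom.summable.mul_right _
  have htail : ∑' r : ℕ, x ^ (r + 2) ≤ 9 / (q : ℝ) ^ 2 := by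
    calc ∑' r : ℕ, x ^ (r + 2) = (∑' r : ℕ, x ^ r) * x ^ 2 := by
          simp_rw [pow_add]; rw [tsum_mul_right]
      _ = (1 - x)⁻¹ * x ^ 2 := by rw [hgeom.tsum_eq]
      _ ≤ 4 * (3 / (2 * (q : ℝ))) ^ 2 := by
          rw [← hx]
          have h14 : (1 - x)⁻¹ ≤ 4 := by
            rw [inv_le_comm₀ (by linarith) (by norm_num)]; linarith
          exact mul_le_mul_of_nonneg_right h14 (sq_nonneg x)
      _ = 9 / (q : ℝ) ^ 2 := by field_simp; ring
  set F : ℕ → ℝ := fun r =>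
    (if r + 1 = 1 then (3 : ℝ) else 3 * (3 / 2 : ℝ) ^ (r + 1)) / (q : ℝ) ^ (r + 1) with hF
  have hshift : ∀ r : ℕ, F (r + 1) = 3 * x ^ (r + 2) := by
    intro r
    simp only [hF, show r + 1 + 1 ≠ 1 by omega, if_false]
    rw [show r + 1 + 1 = r + 2 by ring, mul_div_assoc, ← div_pow, hx, div_div]
  have hs1 : Summable (fun r : ℕ => F (r + 1)) := by
    simp_rw [hshift]; exact hs.mul_left 3
  have hsF : Summable F := (summable_nat_add_iff 1).mp hs1
  refine ⟨hsF, ?_⟩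
  rw [hsF.tsum_eq_zero_add]
  have h0 : F 0 = 3 / q := by simp [hF]
  rw [h0]
  simp_rw [hshift]
  rw [tsum_mul_left]
  have : 3 * ∑' r : ℕ, x ^ (r + 2) ≤ 3 * (9 / (q : ℝ) ^ 2) := mul_le_mul_of_nonneg_left htail (by norm_num)
  calc (3 : ℝ) / q + 3 * ∑' r : ℕ, x ^ (r + 2) ≤ 3 / q + 3 * (9 / (q : ℝ) ^ 2) := by linarith
    _ = 3 / q + 27 / (q : ℝ) ^ 2 := by ring

/-- **The rough-window `τ₃`-sum**: for `2 ≤ D⁴ − 1` and `D⁴ ≤ N`,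
`Σ_{1≤b<N, (b,𝔮)=1} τ₃(b)/b ≤ e^{58 + 48/log(D⁴−1)}·(log N/log(D⁴−1))³` — every such `b` has all its
prime factors in the window `D⁴ ≤ q ≤ N` (`q ∤ 𝔮 = ∏_{q<D⁴}q`), so the tree's window Euler-product
device applies with the majorant of `tau3R_le_multMajorant` (local terms `≤ 3/q + 27/q²`,
`Σ_q 27/q² ≤ 54`). [cite: Zhang2022LandauSiegel, §16 (16.15) p.94] -/
theorem sum_rough_tau3R_div_le {D N : ℕ} (hD : 2 ≤ D ^ 4 - 1) (hN : D ^ 4 ≤ N) :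
    ∑ b ∈ (Finset.Ico 1 N).filter (fun b => Nat.Coprime b (frakq D)), tau3R b / b ≤
      Real.exp (54 + 4 + 16 * (3 : ℕ) / Real.log ((D ^ 4 - 1 : ℕ) : ℝ)) *
        (Real.log N / Real.log ((D ^ 4 - 1 : ℕ) : ℝ)) ^ 3 := by
  classical
  set y : ℕ := D ^ 4 - 1 with hy
  have hyN : y ≤ N := by omega
  set a : ℕ → ℕ → ℝ := fun _ r => if r = 1 then (3 : ℝ) else 3 * (3 / 2 : ℝ) ^ r with ha_def
  have ha0 : ∀ q r, 0 ≤ a q r := by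
    intro q r; simp only [ha_def]; split_ifs <;> positivity
  have hsum : ∀ q : ℕ, q.Prime → Summable fun r : ℕ => a q (r + 1) / (q : ℝ) ^ (r + 1) :=
    fun q hq' => (tau3_local_euler_sum_le hq'.two_le).1
  set s : Finset ℕ := Nat.primesLE N \ Nat.primesLE y with hs_def
  set A := (Finset.Ico 1 N).filter (fun b => Nat.Coprime b (frakq D)) with hA_def
  -- every `b ∈ A` is `s`-factored
  have hA : ∀ b ∈ A, b ∈ Nat.factoredNumbers s := by
    intro b hb
    rw [hA_def, Finset.mem_filter, Finset.mem_Ico] at hb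
    obtain ⟨⟨hb1, hbN⟩, hcop⟩ := hb
    rw [Nat.mem_factoredNumbers_iff_primeFactors_subset]
    refine ⟨by omega, fun q hq => ?_⟩
    have hq' := Nat.mem_primeFactors.mp hq
    have hqp : q.Prime := hq'.1
    have hqb : q ∣ b := hq'.2.1
    -- `q ∤ 𝔮`, i.e. `q ≥ D⁴`
    have hqK : ¬ q ∣ frakq D := fun h =>
      hqp.one_lt.ne' ((Nat.coprime_comm.mp hcop ▸ Nat.Coprime.eq_one_of_dvd (Nat.Coprime.coprime_dvd_left hqb hcop) h))
    have hqge : D ^ 4 ≤ q := by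
      by_contra hlt
      exact hqK ((prime_dvd_frakq_iff hqp).mpr (not_le.mp hlt))
    have hqle : q ≤ N := (Nat.le_of_dvd (by omega) hqb).trans hbN.le
    rw [hs_def, Finset.mem_sdiff, Nat.mem_primesLE, Nat.mem_primesLE]
    exact ⟨⟨hqle, hqp⟩, fun h => by omega⟩
  have hE := sum_factored_multMajorant_div_le_prod ha0 hsum hA
  have hfilt : s.filter Nat.Prime = s := by
    refine Finset.filter_true_of_mem fun q hq => ?_
    rw [hs_def, Finset.mem_sdiff, Nat.mem_primesLE] at hq
    exact hq.1.2
  rw [hfilt] at hE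
  -- local Euler sums `≤ 3/q + 27/q²`, and `Σ_{q ∈ s} 27/q² ≤ 54`
  have hloc : ∀ q ∈ s, ∑' r : ℕ, a q (r + 1) / (q : ℝ) ^ (r + 1) ≤ ((3 : ℕ) : ℝ) / q + 27 / (q : ℝ) ^ 2 := by
    intro q hq
    rw [hs_def, Finset.mem_sdiff, Nat.mem_primesLE] at hq
    have h := (tau3_local_euler_sum_le hq.1.2.two_le).2
    have hrw : (fun r : ℕ => a q (r + 1) / (q : ℝ) ^ (r + 1)) = fun r : ℕ =>
        (if r + 1 = 1 then (3 : ℝ) else 3 * (3 / 2 : ℝ) ^ (r + 1)) / (q : ℝ) ^ (r + 1) := by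
      funext r; rw [ha_def]
    rw [hrw]
    exact h.trans (le_of_eq (by push_cast; ring))
  have hloc0 : ∀ q ∈ s, 0 ≤ ∑' r : ℕ, a q (r + 1) / (q : ℝ) ^ (r + 1) :=
    fun q _ => tsum_nonneg fun r => div_nonneg (ha0 q (r + 1)) (pow_nonneg (Nat.cast_nonneg q) _)
  have hG : ∑ q ∈ s, (27 : ℝ) / (q : ℝ) ^ 2 ≤ 54 := by
    have hH := hasSum_zeta_two
    have hle : ∑ q ∈ s, (1 : ℝ) / (q : ℝ) ^ 2 ≤ Real.pi ^ 2 / 6 :=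
      sum_le_hasSum _ (fun n _ => by positivity) hH
    have hπ : Real.pi ^ 2 / 6 ≤ 2 := by nlinarith [Real.pi_lt_d2, Real.pi_pos]
    calc ∑ q ∈ s, (27 : ℝ) / (q : ℝ) ^ 2 = 27 * ∑ q ∈ s, (1 : ℝ) / (q : ℝ) ^ 2 := by
          rw [Finset.mul_sum]; exact Finset.sum_congr rfl fun q _ => by ring
      _ ≤ 27 * 2 := by nlinarith
      _ = 54 := by norm_num
  have hprod := prod_primes_window_one_add_le hD hyN 3 hloc0 hloc hG
  -- the weights dominate `τ₃`
  have hw : ∀ b ∈ A, tau3R b ≤ ∏ q ∈ b.primeFactors, a q (b.factorization q) := by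
    intro b hb
    have hb0 : b ≠ 0 := by
      have := (Finset.mem_Ico.mp (Finset.mem_filter.mp hb).1).1; omega
    exact tau3R_le_multMajorant hb0
  calc ∑ b ∈ A, tau3R b / b ≤ ∑ b ∈ A, (∏ q ∈ b.primeFactors, a q (b.factorization q)) / b :=
        Finset.sum_le_sum fun b hb => div_le_div_of_nonneg_right (hw b hb) (Nat.cast_nonneg b)
    _ ≤ ∏ q ∈ s, (1 + ∑' r : ℕ, a q (r + 1) / (q : ℝ) ^ (r + 1)) := hE
    _ ≤ Real.exp (54 + 16 * (3 : ℕ) / Real.log y) * (Real.log N / Real.log y) ^ 3 := hprod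
    _ ≤ Real.exp (54 + 4 + 16 * (3 : ℕ) / Real.log y) * (Real.log N / Real.log y) ^ 3 := by
        have hlogy : 0 < Real.log y := Real.log_pos (by exact_mod_cast (show 1 < y by omega))
        have hlogN : 0 ≤ Real.log N := Real.log_natCast_nonneg N
        have h0 : 0 ≤ (Real.log N / Real.log y) ^ 3 := pow_nonneg (div_nonneg hlogN hlogy.le) 3
        exact mul_le_mul_of_nonneg_right (Real.exp_le_exp.mpr (by linarith)) h0

end Literature.NumberTheory.LFunctions.Zhang2022.Typed.Section16B

end
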